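import Summits.HodgeConjecture.HodgeConjecture.Theorems.MarkmanPartnerTransportIsometrySpannedThirdClassEndomorphism
import Literature.AlgebraicGeometry.HodgeTheory.LefschetzOneOneHolds
import HarnessLib

/-!
# Orphan levers, T2 «NEG-LAG»: `σσ̄`-isotropic rational `(2,2)`-classes annihilate `T(X)` under cup product

Sub-problem `HodgeConjecture`, route MarkmanPartnerTransport, rung «ORPHAN-RM» (memo ROUTE-P1AJ, target T2 of
`Sketch_P1AJ_OrphanLevers_g37`, cell hodge-nonav). For a marked smooth projective fourfold `(X, φ, P, z)`
(clauses (m1)–(m6) of the route; `K3^{[2]}`-type is NOT needed) and a RATIONAL class `λ ∈ H⁴(X(ℂ); ℂ)` of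
Hodge type `(2,2)` with `λ ∪ σ ∪ σ̄ = 0` (`σ = φ⁻¹ z`, `σ̄ = φ⁻¹ z̄`):

* `classEndomorphism_period_eq_zero`: the `q`-self-adjoint endomorphism `F_λ` of `H²` attached to `λ`
  (`(λ ∪ y) ∪ w = q(φ F_λ y, φ w) · P`, file `…IsometrySpannedThirdClassEndomorphism`) kills the period:
  `F_λ σ = 0` (`F_λ σ ∈ H^{2,0} = ℂσ` by type preservation, and `q(F_λ σ, σ̄) · P = λ ∪ σ ∪ σ̄ = 0` with
  `q(σ, σ̄) ≠ 0`);
* `classEndomorphism_mem_algebraicClasses`: `im F_λ ⊆ N¹(X)_ℂ` — for the rational basis `αₖ = φ⁻¹ eₖ`,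
  `F_λ αₖ` is rational (`isRationalClass_classEndomorphism`), `q`-orthogonal to `σ` (self-adjointness and
  `F_λ σ = 0`) hence to `σ̄` (reality), so of type `(1,1)` by (m5) and ALGEBRAIC by Lefschetz' theorem on
  `(1,1)`-classes (`lefschetzOneOne_rational_holds`, a tree theorem); extend by linearity;
* `cup3_transcendental_eq_zero_of_cup3_sigma_sigmaBar_eq_zero` (**T2**): `λ ∪ t ∪ y = 0` for every
  `q`-transcendental `t` (i.e. `t ⟂_q N¹(X)`) and every `y ∈ H²(X)`:
  `λ ∪ t ∪ y = q(φ F_λ t, φ y) · P = q(φ t, φ F_λ y) · P = 0`;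
* `cup_kappaClass_eq_zero_of_cup3_sigma_sigmaBar_eq_zero` (**T2, consequence**): `λ ∪ κ(u) = 0` for the
  kappa class `κ(u) = Σ (G⁻¹)ᵢⱼ αᵢ ∪ u(αⱼ)` of ANY endomorphism `u` of `H²(X)` with `q`-transcendental image —
  no `σσ̄`-isotropic (e.g. Lagrangian-supported) rational Hodge class detects an endomorphism class of `T(X)`.

Fact-free: marking clauses, Lefschetz `(1,1)` (tree theorem) and the reality of the Hodge structure (tree
theorems used inside `isOfHodgeType_classEndomorphism`). No definition, no sorry. Credits nothing to the Hodge
conjecture. Prover seat hodge-nonav-20241-p1 (gen 13), `--supports stmt-HodgeConjecture-19653`.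

References: C. Voisin, *Hodge Theory I* §7.1, Thm. 11.30; K. O'Grady, *Mat. Contemp.* (2008) §2;
C. Voisin, in *Complex projective geometry*, LMS LNS 179 (1992) (Lagrangian stability, the excluded case).
-/

noncomputable section

set_option linter.dupNamespace false

open scoped Matrix
open Module CategoryTheory
open Literature.AlgebraicTopology.SingularHomology Literature.Geometry.Kaehler
open Literature.AlgebraicGeometry Literature.AlgebraicGeometry.Motives Literature.AlgebraicGeometry.HodgeTheory
open Literature.AlgebraicGeometry.Hyperkaehler Literature.AlgebraicGeometry.Surfaces
open Summit.HodgeConjecture.HodgeConjecture.Theorems.NikulinTwinTransport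
open Summit.HodgeConjecture.HodgeConjecture.Theorems.MarkmanPartnerTransport.BBFPositivity

namespace Summit.HodgeConjecture.HodgeConjecture.Theorems.MarkmanPartnerTransport.PartnerLattice

/-- `MarkedK3Sq[X, φ, P, z]`: VERBATIM the `let MarkedK3Sq := …` binder of the route declarations of
MarkmanPartnerTransport (clauses (m1)–(m6)). Local notation only. -/
local notation3 (prettyPrint := false) "MarkedK3Sq[" X ", " φ ", " P ", " z "]" =>
  (((IsIntegralClass P ∧ ∀ Q : complexBetti X (2 * 4), IsIntegralClass Q → ∃ n : ℤ, Q = n • P) ∧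
    (∀ c : complexBetti X 2, IsIntegralClass c ↔ ∃ v : K3HilbertIndex → ℤ, φ c = fun i => (v i : ℂ)) ∧
    (∀ a : complexBetti X 2, cupPowTwo a 4 = ((3 : ℂ) * (k3HilbertForm 2 (φ a) (φ a)) ^ 2) • P) ∧
    (IsOfHodgeType 4 X 2 2 0 (LinearEquiv.symm φ z) ∧
      ∀ τ : complexBetti X 2, IsOfHodgeType 4 X 2 2 0 τ → ∃ t : ℂ, τ = t • LinearEquiv.symm φ z) ∧
    (∀ c : complexBetti X 2, IsOfHodgeType 4 X 2 1 1 c ↔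
      (k3HilbertForm 2 (φ c) z = 0 ∧ k3HilbertForm 2 (φ c) (star z) = 0)) ∧
    (k3HilbertForm 2 z z = 0 ∧ 0 < (k3HilbertForm 2 (star z) z).re)))

/-- `Cup3[c, y, w] = (c ∪ y) ∪ w ∈ H⁸` for `c ∈ H⁴`, `y, w ∈ H²`. Local notation only. -/
local notation3 (prettyPrint := false) "Cup3[" c ", " y ", " w "]" =>
  cupProduct (rfl : 2 * 3 + 2 = 2 * 4) (cupProduct (rfl : 2 * 2 + 2 = 2 * 3) c y) w

variable {X : SchemeOver ℂ} {φ : complexBetti X 2 ≃ₗ[ℂ] (K3HilbertIndex → ℂ)} {P : complexBetti X (2 * 4)}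
  {z : K3HilbertIndex → ℂ} {c : complexBetti X (2 * 2)} {F : complexBetti X 2 →ₗ[ℂ] complexBetti X 2}

/-! ### The class endomorphism of a `σσ̄`-isotropic `(2,2)`-class kills the period -/

/-- **`F_c σ = 0`** for `c` of type `(2,2)` with `c ∪ σ ∪ σ̄ = 0`: `F_c σ` has type `(2,0)`, so `F_c σ = t σ`
by (m4), and `t · q(z, z̄) · P = (c ∪ σ) ∪ σ̄ = 0` with `q(z, z̄) ≠ 0` by (m6).
[cite: VoisinHodgeI2002, §7.1.1 and §7.1.2] [cite: Beauville1983, §8] -/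
theorem classEndomorphism_period_eq_zero (hX : IsSmoothProjective 4 X) (hM : MarkedK3Sq[X, φ, P, z])
    (hF : ∀ y w : complexBetti X 2, Cup3[c, y, w] = (k3HilbertForm 2 (φ (F y)) (φ w)) • P)
    (hc22 : IsOfHodgeType 4 X (2 * 2) 2 2 c)
    (hiso : Cup3[c, (LinearEquiv.symm φ) z, (LinearEquiv.symm φ) (star z)] = 0) :
    F (φ.symm z) = 0 := by
  obtain ⟨-, -, -, ⟨hz20, hz20span⟩, -, ⟨-, hzpos⟩⟩ := id hM
  obtain ⟨t, ht⟩ := hz20span _ (isOfHodgeType_classEndomorphism hX hM hF hc22 hz20)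
  have h := hF (φ.symm z) (φ.symm (star z))
  rw [hiso, ht, map_smul, LinearEquiv.apply_symm_apply, LinearEquiv.apply_symm_apply,
    k3HilbertForm_smul_left] at h
  have h0 : t * k3HilbertForm 2 z (star z) = 0 := by
    have h' : (t * k3HilbertForm 2 z (star z)) • P = (0 : ℂ) • P := by rw [zero_smul]; exact h.symm
    exact smul_generator_injective hX hM h'
  have hzz : k3HilbertForm 2 z (star z) ≠ 0 := by
    intro h0'
    rw [k3HilbertForm_comm] at h0'
    rw [h0', Complex.zero_re] at hzpos
    exact lt_irrefl _ hzpos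
  rcases mul_eq_zero.1 h0 with h1 | h1
  · rw [ht, h1, zero_smul]
  · exact absurd h1 hzz

/-- **`im F_c ⟂_q σ`**: `q(φ F_c y, z) = q(φ y, φ F_c σ) = 0` (self-adjointness). [cite: VoisinHodgeI2002, §7.1.2] -/
theorem k3HilbertForm_classEndomorphism_period (hX : IsSmoothProjective 4 X) (hM : MarkedK3Sq[X, φ, P, z])
    (hF : ∀ y w : complexBetti X 2, Cup3[c, y, w] = (k3HilbertForm 2 (φ (F y)) (φ w)) • P)
    (hc22 : IsOfHodgeType 4 X (2 * 2) 2 2 c)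
    (hiso : Cup3[c, (LinearEquiv.symm φ) z, (LinearEquiv.symm φ) (star z)] = 0) (y : complexBetti X 2) :
    k3HilbertForm 2 (φ (F y)) z = 0 := by
  have h := classEndomorphism_selfAdjoint hX hM hF y (φ.symm z)
  rw [LinearEquiv.apply_symm_apply, classEndomorphism_period_eq_zero hX hM hF hc22 hiso, map_zero] at h
  rw [h]
  simp only [k3HilbertForm_eq_dotProduct, Matrix.mulVec_zero, dotProduct_zero]

/-! ### The image of `F_c` is algebraic -/

/-- **`im F_c ⊆ N¹(X)_ℂ`** for a RATIONAL `σσ̄`-isotropic `(2,2)`-class `c`: on the rational basis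
`αₖ = φ⁻¹eₖ`, `F_c αₖ` is rational, `q`-orthogonal to `σ` and (by reality) to `σ̄`, hence of type `(1,1)`
(m5) and algebraic by Lefschetz' theorem on `(1,1)`-classes; `N¹(X)_ℂ` is a `ℂ`-subspace.
[cite: VoisinHodgeI2002, Thm. 11.30 and §7.1.1] -/
theorem classEndomorphism_mem_algebraicClasses (hX : IsSmoothProjective 4 X) (hM : MarkedK3Sq[X, φ, P, z])
    (hF : ∀ y w : complexBetti X 2, Cup3[c, y, w] = (k3HilbertForm 2 (φ (F y)) (φ w)) • P)
    (hc : IsRationalClass c) (hc22 : IsOfHodgeType 4 X (2 * 2) 2 2 c)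
    (hiso : Cup3[c, (LinearEquiv.symm φ) z, (LinearEquiv.symm φ) (star z)] = 0) (y : complexBetti X 2) :
    F y ∈ algebraicClasses X 1 := by
  classical
  obtain ⟨-, hint, -, -, h11, -⟩ := id hM
  have hbasis : ∀ k : K3HilbertIndex, F (φ.symm (Pi.single k 1)) ∈ algebraicClasses X 1 := by
    intro k
    have hαrat : IsRationalClass (φ.symm (Pi.single k 1) : complexBetti X 2) := by
      refine (isRationalClass_iff_of_markedSq hX hint _).2 ⟨Pi.single k 1, ?_⟩
      rw [LinearEquiv.apply_symm_apply]
      funext i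
      by_cases hi : i = k
      · subst hi; simp
      · simp [Pi.single_eq_of_ne hi]
    have hFrat : IsRationalClass (F (φ.symm (Pi.single k 1))) :=
      isRationalClass_classEndomorphism hX hM hF hc hαrat
    obtain ⟨w, hw⟩ := (isRationalClass_iff_of_markedSq hX hint _).1 hFrat
    have hreal : star (φ (F (φ.symm (Pi.single k 1)))) = φ (F (φ.symm (Pi.single k 1))) := by
      rw [hw]
      funext i
      simp only [Pi.star_apply, star_ratCast]
    have hz0 := k3HilbertForm_classEndomorphism_period hX hM hF hc22 hiso (φ.symm (Pi.single k 1))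
    have hzbar0 : k3HilbertForm 2 (φ (F (φ.symm (Pi.single k 1)))) (star z) = 0 := by
      have h := congrArg star hz0
      rwa [star_k3HilbertForm, hreal, star_zero] at h
    exact lefschetzOneOne_rational_holds hX _ hFrat ((h11 _).2 ⟨hz0, hzbar0⟩)
  rw [eq_sum_smul_symm_single φ y, map_sum]
  exact Submodule.sum_mem _ fun k _ => by
    rw [map_smul]
    exact Submodule.smul_mem _ _ (hbasis k)

/-! ### (T2) NEG-LAG -/

/-- **(T2) `σσ̄`-isotropic rational Hodge classes annihilate `T(X)`.** For a marked smooth projective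
fourfold (clauses (m1)–(m6)) and a RATIONAL class `λ ∈ H⁴(X)` of type `(2,2)` with `λ ∪ σ ∪ σ̄ = 0`,
`λ ∪ t ∪ y = 0` for every `q`-transcendental `t` and every `y ∈ H²(X)`:
`λ ∪ t ∪ y = q(φ F_λ t, φ y) · P = q(φ t, φ F_λ y) · P` and `F_λ y ∈ N¹(X)_ℂ ⟂_q t`.
[cite: VoisinHodgeI2002, §7.1.2 and Thm. 11.30] -/
theorem cup3_transcendental_eq_zero_of_cup3_sigma_sigmaBar_eq_zero
    (hX : IsSmoothProjective 4 X) (hM : MarkedK3Sq[X, φ, P, z])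
    {lam : complexBetti X (2 * 2)} (hrat : IsRationalClass lam) (hH : IsOfHodgeType 4 X (2 * 2) 2 2 lam)
    (hiso : Cup3[lam, (LinearEquiv.symm φ) z, (LinearEquiv.symm φ) (star z)] = 0)
    (t : complexBetti X 2)
    (ht : ∀ e : complexBetti X 2, e ∈ algebraicClasses X 1 → k3HilbertForm 2 (φ t) (φ e) = 0)
    (y : complexBetti X 2) :
    Cup3[lam, t, y] = 0 := by
  obtain ⟨F, hF⟩ := exists_classEndomorphism hX hM lam
  rw [hF, classEndomorphism_selfAdjoint hX hM hF,
    ht _ (classEndomorphism_mem_algebraicClasses hX hM hF hrat hH hiso y), zero_smul]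

/-- **(T2, consequence) `σσ̄`-isotropic rational Hodge classes are blind to endomorphism classes**: with `λ`
as above and `u` ANY endomorphism of `H²(X)` with `q`-transcendental image, `λ ∪ κ(u) = 0` where
`κ(u) = Σ (G⁻¹)ᵢⱼ φ⁻¹eᵢ ∪ u(φ⁻¹eⱼ)` is the kappa class: termwise
`λ ∪ (αᵢ ∪ u αⱼ) = (λ ∪ αᵢ) ∪ u αⱼ = q(φ F_λ αᵢ, φ (u αⱼ)) · P = 0` since `F_λ αᵢ ∈ N¹(X)_ℂ ⟂_q u αⱼ`.
[cite: VoisinHodgeI2002, §7.1.2 and Thm. 11.30] [cite: HatcherAT2002, §3.2 p. 211] -/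
theorem cup_kappaClass_eq_zero_of_cup3_sigma_sigmaBar_eq_zero
    (hX : IsSmoothProjective 4 X) (hM : MarkedK3Sq[X, φ, P, z])
    {lam : complexBetti X (2 * 2)} (hrat : IsRationalClass lam) (hH : IsOfHodgeType 4 X (2 * 2) 2 2 lam)
    (hiso : Cup3[lam, (LinearEquiv.symm φ) z, (LinearEquiv.symm φ) (star z)] = 0)
    (u : complexBetti X 2 →ₗ[ℂ] complexBetti X 2)
    (hu : ∀ y : complexBetti X 2, ∀ e : complexBetti X 2, e ∈ algebraicClasses X 1 →
      k3HilbertForm 2 (φ (u y)) (φ e) = 0) :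
    cupProduct (rfl : 2 * 2 + 2 * 2 = 2 * 4) lam
      (∑ i : K3HilbertIndex, ∑ j : K3HilbertIndex,
        (((k3HilbertGram 2).map (Int.cast : ℤ → ℂ))⁻¹ i j) •
          cupProduct (rfl : 2 + 2 = 2 * 2) ((LinearEquiv.symm φ) (Pi.single i 1))
            (u ((LinearEquiv.symm φ) (Pi.single j 1)))) = 0 := by
  obtain ⟨F, hF⟩ := exists_classEndomorphism hX hM lam
  rw [map_sum]
  refine Finset.sum_eq_zero fun i _ => ?_
  rw [map_sum]
  refine Finset.sum_eq_zero fun j _ => ?_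
  rw [map_smul, ← cupProduct_assoc (rfl : 2 * 2 + 2 = 2 * 3) (rfl : 2 + 2 = 2 * 2) (rfl : 2 * 3 + 2 = 2 * 4)
    (rfl : 2 * 2 + 2 * 2 = 2 * 4) lam, hF, k3HilbertForm_comm,
    hu _ _ (classEndomorphism_mem_algebraicClasses hX hM hF hrat hH hiso _), zero_smul, smul_zero]

end Summit.HodgeConjecture.HodgeConjecture.Theorems.MarkmanPartnerTransport.PartnerLattice

end
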